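import Summits.QuantumFields.BalabanUV.Beta.GAN24.Lin4LegTowerUnroll
import Summits.QuantumFields.BalabanUV.Beta.GAN24.LegSlotDivergenceCommute

/-!
# `BalabanUV.Beta.GAN24.MixedSlotCarrier` — binder row G-an2-4 ∕ (CONV-C), W-slot, the (α-0) parity re-cut, located crux (Q-L-k₀), the DRIFT rows
# (leaf-03 g68 FILE 4 v4 `HΔw`; OWNER `b2b-balaban-gan24-p1` gen 37, part 9 — OFFERED TO leaf-01 (first refusal), statement-first):
# **THE ONE-STEP LEG MAP IS TRILINEAR IN ITS KERNEL — THE MIXED-SLOT STEP `legStep₃ kc G₁ G₂ K` AND THE THREE-TERM DIFFERENCE IDENTITY.**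

NOT IN PRINT; OUR BOOKKEEPING ([folklore] multilinear algebra on leaf-03's `Lin4LegTower.legStep` ∕ leaf-04's `vsym` ∕ an2's `vertex2OfK` ∕ an4's `vertexOfK`,
with the summability of gan24-p2's `Lin4Additive` (decaying kernels, bounded tables); 3 plumbing `def`s asserting nothing, 0 cited facts, 0 `def … : Prop`, 0 sorry).
HONEST FRAMING (cell contract, verbatim): «discharging `BetaPertH` makes Bałaban's UV stability UNCONDITIONAL — a real constructive-QFT result; it is NOT the
continuum limit and NOT the Clay problem.»  HONEST DEPENDENCY (verbatim): «continuum YM on T⁴ ⇐ BetaPertH ∧ nine spine estimates (0/9 proved); BetaPertH ⇐ (D1) ∧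
(D4) ∧ CAP+tail; G-an2-4 gates asym, D1 and NE2/3/4.»

WHY (SPEC `HOME/b2b-balaban-gan24-p1/gen37/SPEC-H1Dw-mixed-carrier.md` §1–§2).  leaf-03's `HΔw` window carries, at its lowest step, the DIFFERENCE of two one-step
leg maps `legStepB kc K♮ Lc (l+1) W − legStepB kc K♮ Lc l W`; with the level-constant `kc` this is `legStep kc M₁ M₁ Lc (𝔹W) − legStep kc M₀ M₀ Lc (𝔹W)`,
`M₁ = K♮_{l+1}`, `M₀ = K♮_l`, and `legStep kc G K N W = kc • mreadL N (K ∘ vsym G N W)` is of degree TWO in `G` (the two slot legs of the bi-vertex) and ONE in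
`K` (the kernel leg).  The smallness `M₁ − M₀ = O(θ^l)` (MY part 7 `DressedStepDifferenceRows`) can only be isolated by a carrier whose two SLOT legs come from
DIFFERENT kernels — with diagonal carriers `B(a,a) − B(b,b) = B(c,c) + B(b,c) + B(c,b)` never closes.  THIS FILE (generic `d`):
* §1 `vertex2OfK₂ G₁ G₂ N T` (slot 1 of `T` through `G₁`'s columns, slot 2 through `G₂`'s), `vsym₂`, **`legStep₃ kc G₁ G₂ K N W`**; `rfl` collapses
  `vertex2OfK₂ G G = vertex2OfK G`, `vsym₂ G G = vsym G`, `legStep₃ kc G G K = legStep kc G K`; entry bounds on bounded tables (`abs_vertex2OfK₂_le`, `abs_vsym₂_le`).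
* §2 LINEARITY in each of the three kernels on bounded tables (decaying kernels): `vertexOfK_sub_kernel`, `legStep₃_sub_fst`, `legStep₃_sub_snd`, `legStep₃_sub_kernel`.
* §3 **`legStep_sub_legStep_eq_three`**: `legStep kc M₁ M₁ N W − legStep kc M₀ M₀ N W = legStep₃ kc (M₁−M₀) M₁ M₁ N W + legStep₃ kc M₀ (M₁−M₀) M₁ N W + legStep₃ kc M₀ M₀ (M₁−M₀) N W`.
* §4 RE-ROOTING letters for the binder: `legStepB_update_succ` (`legStepB kc (update K (l+1) (K l)) N (l+1) = legStepB kc K N l` when `kc (l+1) = kc l`) and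
  `legChain_congr` (the source chain `legChain kc K N m k` sees only the levels `m … m+k−1`).
NOT HERE: the composite (k-fold) mixed carrier and its bounds ((ii)₂ ∕ (iii)₂ of the SPEC — leaf-01's), the socket call (MY successor's).  Asserts NOTHING about
Bałaban's tables; NOT (H1Δw); NOTHING of (Q-L) ∕ (C)sym discharged; NEVER «G-an2-4 closed» as (CONV-C); NOT D1, NOT `BetaPertH`, NOT continuum, NOT Clay; not in print.
-/

noncomputable section

open Finset
open scoped BigOperators
open Literature.MathematicalPhysics.QuantumFieldTheory
open Literature.MathematicalPhysics.QuantumFieldTheory.Balaban1983to89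
open Literature.MathematicalPhysics.QuantumFieldTheory.Balaban1983to89.Beta
open B12Sec2to5 (l1 l1_nonneg)
open ExpKernelCalculus (MKer Site Decays comp Zl Zl_nonneg summable_exp_shift summable_exp_shift')
open OneStepResolventKernel (Fib wsum)
open OneStepKernelFamily (colH vertexOfK abs_colH_le)
open SecondOrderResponse (vertex2OfK)
open KernelWard (Bdd comp_sub_left)
open StepJetData (comp_add_right)
open Summit.QuantumFields.BalabanUV.Beta.ChartConjugationReflection (vertexOfK_add vertexOfK_neg)
open Summit.QuantumFields.BalabanUV.Beta.GAN24.T2RecursionAffine (vsym)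
open Summit.QuantumFields.BalabanUV.Beta.GAN24.Lin4Additive (abs_vertexOfK_le summable_slices_decays_bdd)
open Summit.QuantumFields.BalabanUV.Beta.GAN24.Lin4LegTower (mreadL legStep legStep_inl legStep_inr)
open Summit.QuantumFields.BalabanUV.Beta.GAN24.Lin4LegTowerUnroll (legStepB legChain)
open Summit.QuantumFields.BalabanUV.Beta.GAN24.LegSlotDivergenceCommute (mreadL_sub)
open Summit.QuantumFields.BalabanUV.Beta.GAN24.BiStencilZeroMode (Tab)

namespace Summit.QuantumFields.BalabanUV.Beta.GAN24.MixedSlotCarrier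

variable {d : ℕ}

/-! ## §1 The mixed-slot objects -/

/-- [folklore] Plumbing `def`: **THE BI-VERTEX WITH TWO KERNELS** — slot 1 of the table through `G₁`'s `ℋ`-columns, slot 2 through `G₂`'s:
`vertex2OfK₂ G₁ G₂ N T μ y ν y′ := vertexOfK G₁ N (fun κ u ↦ vertexOfK G₂ N (T κ u) ν y′) μ y` (an2's `vertex2OfK` is the diagonal `G₁ = G₂`).  Asserts nothing. -/
def vertex2OfK₂ (G₁ G₂ : MKer (d + 1) (Fib d)) (N : ℕ) (T : Tab d)
    (μ : Fin (d + 1)) (y : Fin (d + 1) → ℤ) (ν : Fin (d + 1)) (y' : Fin (d + 1) → ℤ) : MKer (d + 1) (Fib d) :=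
  vertexOfK G₁ N (fun κ u => vertexOfK G₂ N (T κ u) ν y') μ y

/-- [folklore] Plumbing `def`: **THE SYMMETRISED MIXED BI-VERTEX** `vsym₂ G₁ G₂ N T μ y ν y′ := ½ • (vertex2OfK₂ G₁ G₂ N T μ y ν y′ + vertex2OfK₂ G₁ G₂ N T ν y′ μ y)`
(the kernel is attached to the SLOT of `T`, not to the outer index: in the swapped term `G₁` still dresses slot 1).  Asserts nothing. -/
def vsym₂ (G₁ G₂ : MKer (d + 1) (Fib d)) (N : ℕ) (T : Tab d)
    (μ : Fin (d + 1)) (y : Fin (d + 1) → ℤ) (ν : Fin (d + 1)) (y' : Fin (d + 1) → ℤ) : MKer (d + 1) (Fib d) :=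
  (1 / 2 : ℝ) • (vertex2OfK₂ G₁ G₂ N T μ y ν y' + vertex2OfK₂ G₁ G₂ N T ν y' μ y)

/-- [folklore] Plumbing `def`: **THE MIXED-SLOT ONE-STEP LEG MAP** `legStep₃ kc G₁ G₂ K N W s := kc • mreadL N (K ∘ vsym₂ G₁ G₂ N W s)` — slot legs from `G₁`, `G₂`,
kernel leg from `K` (leaf-03's `legStep kc G K` is the diagonal `G₁ = G₂ = G`).  Asserts nothing. -/
def legStep₃ (kc : ℝ) (G₁ G₂ K : MKer (d + 1) (Fib d)) (N : ℕ) (W : Tab d)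
    (κ : Fin (d + 1)) (u : Fin (d + 1) → ℤ) (κ' : Fin (d + 1)) (u' : Fin (d + 1) → ℤ) : MKer (d + 1) (Fib d) :=
  kc • mreadL N (comp K (vsym₂ G₁ G₂ N W κ u κ' u'))

/-- [folklore] The diagonal of `vertex2OfK₂` is an2's `vertex2OfK` (`rfl`). -/
theorem vertex2OfK₂_self (G : MKer (d + 1) (Fib d)) (N : ℕ) (T : Tab d) : vertex2OfK₂ G G N T = vertex2OfK G N T := rfl

/-- [folklore] The diagonal of `vsym₂` is leaf-04's `vsym` (`rfl`). -/
theorem vsym₂_self (G : MKer (d + 1) (Fib d)) (N : ℕ) (T : Tab d) : vsym₂ G G N T = vsym G N T := rfl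

/-- [folklore] The diagonal of `legStep₃` is leaf-03's `legStep` (`rfl`). -/
theorem legStep₃_self (kc : ℝ) (G K : MKer (d + 1) (Fib d)) (N : ℕ) (W : Tab d) : legStep₃ kc G G K N W = legStep kc G K N W := rfl

section Bounds

variable {G₁ G₂ : MKer (d + 1) (Fib d)} {C₁ δ₁ C₂ δ₂ B : ℝ} {N : ℕ} {T : Tab d}

/-- [folklore] Entry bound of the mixed bi-vertex on a bounded table (gan24-p2's `abs_vertexOfK_le` twice). -/
theorem abs_vertex2OfK₂_le (hG₁ : Decays G₁ C₁ δ₁) (hδ₁ : 0 < δ₁) (hG₂ : Decays G₂ C₂ δ₂) (hδ₂ : 0 < δ₂)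
    (hT : ∀ κ u κ' u' x z a b, |T κ u κ' u' x z a b| ≤ B)
    (μ : Fin (d + 1)) (y : Fin (d + 1) → ℤ) (ν : Fin (d + 1)) (y' x z : Fin (d + 1) → ℤ) (a b : Fib d) :
    |vertex2OfK₂ G₁ G₂ N T μ y ν y' x z a b| ≤ ((d + 1 : ℕ) : ℝ) * (C₁ * Zl (d + 1) δ₁ * (((d + 1 : ℕ) : ℝ) * (C₂ * Zl (d + 1) δ₂ * B))) :=
  abs_vertexOfK_le hG₁ hδ₁ N (S := fun κ u => vertexOfK G₂ N (T κ u) ν y')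
    (fun κ u x z a b => abs_vertexOfK_le hG₂ hδ₂ N (hT κ u) ν y' x z a b) μ y x z a b

/-- [folklore] Entry bound of the symmetrised mixed bi-vertex (same constant). -/
theorem abs_vsym₂_le (hG₁ : Decays G₁ C₁ δ₁) (hδ₁ : 0 < δ₁) (hG₂ : Decays G₂ C₂ δ₂) (hδ₂ : 0 < δ₂)
    (hT : ∀ κ u κ' u' x z a b, |T κ u κ' u' x z a b| ≤ B)
    (μ : Fin (d + 1)) (y : Fin (d + 1) → ℤ) (ν : Fin (d + 1)) (y' : Fin (d + 1) → ℤ) :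
    Bdd (vsym₂ G₁ G₂ N T μ y ν y') (((d + 1 : ℕ) : ℝ) * (C₁ * Zl (d + 1) δ₁ * (((d + 1 : ℕ) : ℝ) * (C₂ * Zl (d + 1) δ₂ * B)))) := by
  intro x z a b
  have h1 := abs_vertex2OfK₂_le (N := N) hG₁ hδ₁ hG₂ hδ₂ hT μ y ν y' x z a b
  have h2 := abs_vertex2OfK₂_le (N := N) hG₁ hδ₁ hG₂ hδ₂ hT ν y' μ y x z a b
  simp only [vsym₂, Pi.smul_apply, Pi.add_apply, smul_eq_mul]
  rw [abs_mul, abs_of_pos (by norm_num : (0 : ℝ) < 1 / 2)]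
  have h3 := abs_add_le (vertex2OfK₂ G₁ G₂ N T μ y ν y' x z a b) (vertex2OfK₂ G₁ G₂ N T ν y' μ y x z a b)
  nlinarith

end Bounds

/-! ## §2 Linearity in each kernel (decaying kernels, bounded tables) -/

section Linear

variable {G G' G₁ G₂ K K' : MKer (d + 1) (Fib d)} {C δ C' δ' C₁ δ₁ C₂ δ₂ CK δK CK' δK' B : ℝ} {N : ℕ}

/-- [folklore] A decaying kernel's column against a bounded slice is summable. -/
theorem summable_colH_mul (hG : Decays G C δ) (hδ : 0 < δ) {S : (Fin (d + 1) → ℤ) → MKer (d + 1) (Fib d)} (hS : ∀ u x z a b, |S u x z a b| ≤ B)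
    (μ : Fin (d + 1)) (y : Fin (d + 1) → ℤ) (κ' : Fin (d + 1)) (x z : Fin (d + 1) → ℤ) (a b : Fib d) :
    Summable fun u => colH G N μ y κ' u * S u x z a b := by
  refine Summable.of_norm_bounded (((summable_exp_shift' hδ ((N : ℤ) • y)).mul_left C).mul_right B) (fun u => ?_)
  rw [Real.norm_eq_abs, abs_mul]
  exact mul_le_mul (abs_colH_le (N := N) hG μ y κ' u) (hS u x z a b) (abs_nonneg _) ((abs_nonneg _).trans (abs_colH_le (N := N) hG μ y κ' u))

/-- [folklore] **THE CHAIN-RULE VERTEX IS LINEAR IN ITS KERNEL** on bounded families: `vertexOfK (G − G′) N S = vertexOfK G N S − vertexOfK G′ N S`. -/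
theorem vertexOfK_sub_kernel (hG : Decays G C δ) (hδ : 0 < δ) (hG' : Decays G' C' δ') (hδ' : 0 < δ') (N : ℕ)
    {S : Fin (d + 1) → (Fin (d + 1) → ℤ) → MKer (d + 1) (Fib d)} (hS : ∀ κ' u x z a b, |S κ' u x z a b| ≤ B)
    (μ : Fin (d + 1)) (y : Fin (d + 1) → ℤ) :
    vertexOfK (G - G') N S μ y = vertexOfK G N S μ y - vertexOfK G' N S μ y := by
  funext x z a b
  show (∑ κ' : Fin (d + 1), wsum (colH (G - G') N μ y κ') (S κ') x z a b)
      = (∑ κ' : Fin (d + 1), wsum (colH G N μ y κ') (S κ') x z a b) - ∑ κ' : Fin (d + 1), wsum (colH G' N μ y κ') (S κ') x z a b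
  rw [← Finset.sum_sub_distrib]
  refine Finset.sum_congr rfl fun κ' _ => ?_
  show (∑' u, colH (G - G') N μ y κ' u * S κ' u x z a b) = (∑' u, colH G N μ y κ' u * S κ' u x z a b) - ∑' u, colH G' N μ y κ' u * S κ' u x z a b
  rw [← (summable_colH_mul hG hδ (hS κ') μ y κ' x z a b).tsum_sub (summable_colH_mul hG' hδ' (hS κ') μ y κ' x z a b)]
  refine tsum_congr fun u => ?_
  simp only [colH, Pi.sub_apply]
  ring

/-- [folklore] The mixed bi-vertex is linear in its FIRST kernel on bounded tables. -/
theorem vertex2OfK₂_sub_fst (hG : Decays G C δ) (hδ : 0 < δ) (hG' : Decays G' C' δ') (hδ' : 0 < δ') (hG₂ : Decays G₂ C₂ δ₂) (hδ₂ : 0 < δ₂)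
    {T : Tab d} (hT : ∀ κ u κ' u' x z a b, |T κ u κ' u' x z a b| ≤ B)
    (μ : Fin (d + 1)) (y : Fin (d + 1) → ℤ) (ν : Fin (d + 1)) (y' : Fin (d + 1) → ℤ) :
    vertex2OfK₂ (G - G') G₂ N T μ y ν y' = vertex2OfK₂ G G₂ N T μ y ν y' - vertex2OfK₂ G' G₂ N T μ y ν y' :=
  vertexOfK_sub_kernel hG hδ hG' hδ' N (S := fun κ u => vertexOfK G₂ N (T κ u) ν y')
    (fun κ u x z a b => abs_vertexOfK_le hG₂ hδ₂ N (hT κ u) ν y' x z a b) μ y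

/-- [folklore] The mixed bi-vertex is linear in its SECOND kernel on bounded tables. -/
theorem vertex2OfK₂_sub_snd (hG₁ : Decays G₁ C₁ δ₁) (hδ₁ : 0 < δ₁) (hC₁ : 0 ≤ C₁) (hG : Decays G C δ) (hδ : 0 < δ) (hG' : Decays G' C' δ') (hδ' : 0 < δ')
    {T : Tab d} (hT : ∀ κ u κ' u' x z a b, |T κ u κ' u' x z a b| ≤ B)
    (μ : Fin (d + 1)) (y : Fin (d + 1) → ℤ) (ν : Fin (d + 1)) (y' : Fin (d + 1) → ℤ) :
    vertex2OfK₂ G₁ (G - G') N T μ y ν y' = vertex2OfK₂ G₁ G N T μ y ν y' - vertex2OfK₂ G₁ G' N T μ y ν y' := by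
  have hin : (fun κ u => vertexOfK (G - G') N (T κ u) ν y') = fun κ u => vertexOfK G N (T κ u) ν y' + -vertexOfK G' N (T κ u) ν y' := by
    funext κ u
    rw [vertexOfK_sub_kernel hG hδ hG' hδ' N (hT κ u) ν y', sub_eq_add_neg]
  -- a common bound for the two inner families
  have hB : 0 ≤ B := (abs_nonneg _).trans (hT 0 0 0 0 0 0 (Sum.inl 0) (Sum.inl 0))
  set M : ℝ := max (((d + 1 : ℕ) : ℝ) * (C * Zl (d + 1) δ * B)) (((d + 1 : ℕ) : ℝ) * (C' * Zl (d + 1) δ' * B)) with hM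
  have hS : ∀ κ u x z a b, |vertexOfK G N (T κ u) ν y' x z a b| ≤ M :=
    fun κ u x z a b => (abs_vertexOfK_le hG hδ N (hT κ u) ν y' x z a b).trans (le_max_left _ _)
  have hS' : ∀ κ u x z a b, |(-vertexOfK G' N (T κ u) ν y') x z a b| ≤ M := fun κ u x z a b => by
    rw [Pi.neg_apply, Pi.neg_apply, Pi.neg_apply, Pi.neg_apply, abs_neg]
    exact (abs_vertexOfK_le hG' hδ' N (hT κ u) ν y' x z a b).trans (le_max_right _ _)
  unfold vertex2OfK₂
  rw [hin, vertexOfK_add ⟨δ₁, C₁, hδ₁, hC₁, hG₁⟩ hS hS' μ y, vertexOfK_neg, ← sub_eq_add_neg]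

/-- [folklore] **`legStep₃` IS LINEAR IN ITS FIRST SLOT KERNEL** (bounded table; all kernels decaying). -/
theorem legStep₃_sub_fst (hG : Decays G C δ) (hδ : 0 < δ) (hG' : Decays G' C' δ') (hδ' : 0 < δ') (hG₂ : Decays G₂ C₂ δ₂) (hδ₂ : 0 < δ₂)
    (hK : Decays K CK δK) (hδK : 0 < δK) (kc : ℝ) {W : Tab d} (hW : ∀ κ u κ' u' x z a b, |W κ u κ' u' x z a b| ≤ B)
    (κ : Fin (d + 1)) (u : Fin (d + 1) → ℤ) (κ' : Fin (d + 1)) (u' : Fin (d + 1) → ℤ) :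
    legStep₃ kc (G - G') G₂ K N W κ u κ' u' = legStep₃ kc G G₂ K N W κ u κ' u' - legStep₃ kc G' G₂ K N W κ u κ' u' := by
  have hV := abs_vsym₂_le (N := N) hG hδ hG₂ hδ₂ hW
  have hV' := abs_vsym₂_le (N := N) hG' hδ' hG₂ hδ₂ hW
  have hsym : vsym₂ (G - G') G₂ N W κ u κ' u' = vsym₂ G G₂ N W κ u κ' u' + -vsym₂ G' G₂ N W κ u κ' u' := by
    simp only [vsym₂, vertex2OfK₂_sub_fst (N := N) hG hδ hG' hδ' hG₂ hδ₂ hW]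
    rw [← sub_eq_add_neg, ← smul_sub]
    congr 1
    abel
  have hneg : ∀ V : MKer (d + 1) (Fib d), comp K (-V) = -comp K V := fun V => by
    funext x z a b
    simp only [comp, Pi.neg_apply, mul_neg, Finset.sum_neg_distrib, tsum_neg]
  have hBn : ∀ {V : MKer (d + 1) (Fib d)} {BV : ℝ}, Bdd V BV → Bdd (-V) BV := fun hV x z a b => by
    rw [Pi.neg_apply, Pi.neg_apply, Pi.neg_apply, Pi.neg_apply, abs_neg]; exact hV x z a b
  unfold legStep₃
  rw [hsym, comp_add_right (summable_slices_decays_bdd hK hδK (hV κ u κ' u')) (summable_slices_decays_bdd hK hδK (hBn (hV' κ u κ' u'))),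
    hneg, ← sub_eq_add_neg, mreadL_sub, smul_sub]

/-- [folklore] **`legStep₃` IS LINEAR IN ITS SECOND SLOT KERNEL** (bounded table; all kernels decaying). -/
theorem legStep₃_sub_snd (hG₁ : Decays G₁ C₁ δ₁) (hδ₁ : 0 < δ₁) (hC₁ : 0 ≤ C₁) (hG : Decays G C δ) (hδ : 0 < δ) (hG' : Decays G' C' δ') (hδ' : 0 < δ')
    (hK : Decays K CK δK) (hδK : 0 < δK) (kc : ℝ) {W : Tab d} (hW : ∀ κ u κ' u' x z a b, |W κ u κ' u' x z a b| ≤ B)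
    (κ : Fin (d + 1)) (u : Fin (d + 1) → ℤ) (κ' : Fin (d + 1)) (u' : Fin (d + 1) → ℤ) :
    legStep₃ kc G₁ (G - G') K N W κ u κ' u' = legStep₃ kc G₁ G K N W κ u κ' u' - legStep₃ kc G₁ G' K N W κ u κ' u' := by
  have hV := abs_vsym₂_le (N := N) hG₁ hδ₁ hG hδ hW
  have hV' := abs_vsym₂_le (N := N) hG₁ hδ₁ hG' hδ' hW
  have hsym : vsym₂ G₁ (G - G') N W κ u κ' u' = vsym₂ G₁ G N W κ u κ' u' + -vsym₂ G₁ G' N W κ u κ' u' := by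
    simp only [vsym₂, vertex2OfK₂_sub_snd (N := N) hG₁ hδ₁ hC₁ hG hδ hG' hδ' hW]
    rw [← sub_eq_add_neg, ← smul_sub]
    congr 1
    abel
  have hneg : ∀ V : MKer (d + 1) (Fib d), comp K (-V) = -comp K V := fun V => by
    funext x z a b
    simp only [comp, Pi.neg_apply, mul_neg, Finset.sum_neg_distrib, tsum_neg]
  have hBn : ∀ {V : MKer (d + 1) (Fib d)} {BV : ℝ}, Bdd V BV → Bdd (-V) BV := fun hV x z a b => by
    rw [Pi.neg_apply, Pi.neg_apply, Pi.neg_apply, Pi.neg_apply, abs_neg]; exact hV x z a b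
  unfold legStep₃
  rw [hsym, comp_add_right (summable_slices_decays_bdd hK hδK (hV κ u κ' u')) (summable_slices_decays_bdd hK hδK (hBn (hV' κ u κ' u'))),
    hneg, ← sub_eq_add_neg, mreadL_sub, smul_sub]

/-- [folklore] **`legStep₃` IS LINEAR IN ITS KERNEL LEG** (bounded table; all kernels decaying; `KernelWard.comp_sub_left`). -/
theorem legStep₃_sub_kernel (hG₁ : Decays G₁ C₁ δ₁) (hδ₁ : 0 < δ₁) (hG₂ : Decays G₂ C₂ δ₂) (hδ₂ : 0 < δ₂)
    (hK : Decays K CK δK) (hδK : 0 < δK) (hK' : Decays K' CK' δK') (hδK' : 0 < δK') (kc : ℝ) {W : Tab d}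
    (hW : ∀ κ u κ' u' x z a b, |W κ u κ' u' x z a b| ≤ B)
    (κ : Fin (d + 1)) (u : Fin (d + 1) → ℤ) (κ' : Fin (d + 1)) (u' : Fin (d + 1) → ℤ) :
    legStep₃ kc G₁ G₂ (K - K') N W κ u κ' u' = legStep₃ kc G₁ G₂ K N W κ u κ' u' - legStep₃ kc G₁ G₂ K' N W κ u κ' u' := by
  have hV := abs_vsym₂_le (N := N) hG₁ hδ₁ hG₂ hδ₂ hW κ u κ' u'
  unfold legStep₃
  rw [comp_sub_left (summable_slices_decays_bdd hK hδK hV) (summable_slices_decays_bdd hK' hδK' hV), mreadL_sub, smul_sub]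

end Linear

/-! ## §3 The three-term difference identity -/

/-- NOT IN PRINT; OUR BOOKKEEPING.  **THE DIFFERENCE OF TWO ONE-STEP LEG MAPS IS THE SUM OF THREE MIXED STEPS, EACH WITH EXACTLY ONE DIFFERENCE LEG**
(`M₀`, `M₁` decaying, `W` bounded): `legStep kc M₁ M₁ N W − legStep kc M₀ M₀ N W
 = legStep₃ kc (M₁−M₀) M₁ M₁ N W + legStep₃ kc M₀ (M₁−M₀) M₁ N W + legStep₃ kc M₀ M₀ (M₁−M₀) N W` (entrywise in the outer index `s = (κ,u,κ′,u′)`). -/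
theorem legStep_sub_legStep_eq_three {M₀ M₁ : MKer (d + 1) (Fib d)} {C₀ δ₀ C₁ δ₁ B : ℝ} {N : ℕ}
    (hM₀ : Decays M₀ C₀ δ₀) (hδ₀ : 0 < δ₀) (hC₀ : 0 ≤ C₀) (hM₁ : Decays M₁ C₁ δ₁) (hδ₁ : 0 < δ₁) (kc : ℝ)
    {W : Tab d} (hW : ∀ κ u κ' u' x z a b, |W κ u κ' u' x z a b| ≤ B)
    (κ : Fin (d + 1)) (u : Fin (d + 1) → ℤ) (κ' : Fin (d + 1)) (u' : Fin (d + 1) → ℤ) :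
    legStep kc M₁ M₁ N W κ u κ' u' - legStep kc M₀ M₀ N W κ u κ' u'
      = legStep₃ kc (M₁ - M₀) M₁ M₁ N W κ u κ' u' + legStep₃ kc M₀ (M₁ - M₀) M₁ N W κ u κ' u'
        + legStep₃ kc M₀ M₀ (M₁ - M₀) N W κ u κ' u' := by
  rw [legStep₃_sub_fst (N := N) hM₁ hδ₁ hM₀ hδ₀ hM₁ hδ₁ hM₁ hδ₁ kc hW,
    legStep₃_sub_snd (N := N) hM₀ hδ₀ hC₀ hM₁ hδ₁ hM₀ hδ₀ hM₁ hδ₁ kc hW,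
    legStep₃_sub_kernel (N := N) hM₀ hδ₀ hM₀ hδ₀ hM₁ hδ₁ hM₀ hδ₀ kc hW,
    ← legStep₃_self kc M₁ M₁ N W, ← legStep₃_self kc M₀ M₀ N W]
  abel

/-! ## §4 Re-rooting letters for the binder -/

section Reroot

variable {kc : ℕ → ℝ} {K : ℕ → MKer (d + 1) (Fib d)} {N : ℕ}

/-- [folklore] **THE LOWER STEP IS THE UPPER STEP OF THE SWAPPED FAMILY**: if the scalar is the same at the two levels, `legStepB kc (update K (l+1) (K l)) N (l+1) = legStepB kc K N l`
(`legStepB kc F N n` sees only `kc n` and `F n`). -/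
theorem legStepB_update_succ (l : ℕ) (hkc : kc (l + 1) = kc l) :
    legStepB kc (Function.update K (l + 1) (K l)) N (l + 1) = legStepB kc K N l := by
  funext W κ u κ' u'
  simp only [legStepB, Function.update_self, hkc]

/-- [folklore] **THE SOURCE CHAIN SEES ONLY ITS OWN LEVELS**: if `K j = K′ j` and `kc j = kc′ j` for `m ≤ j < m + k` then `legChain kc K N m k = legChain kc′ K′ N m k`. -/
theorem legChain_congr {kc' : ℕ → ℝ} {K' : ℕ → MKer (d + 1) (Fib d)} {m : ℕ} :
    ∀ {k : ℕ}, (∀ j, m ≤ j → j < m + k → K j = K' j) → (∀ j, m ≤ j → j < m + k → kc j = kc' j) →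
      legChain kc K N m k = legChain kc' K' N m k
  | 0, _, _ => rfl
  | k + 1, hK, hkc => by
    have ih := legChain_congr (k := k) (fun j h1 h2 => hK j h1 (by omega)) (fun j h1 h2 => hkc j h1 (by omega))
    funext W κ u κ' u'
    show legStep (kc (m + k)) (K (m + k)) (K (m + k)) N (legChain kc K N m k W) κ u κ' u'
      = legStep (kc' (m + k)) (K' (m + k)) (K' (m + k)) N (legChain kc' K' N m k W) κ u κ' u'
    rw [ih, hK (m + k) (by omega) (by omega), hkc (m + k) (by omega) (by omega)]

/-- [folklore] In particular the chain from level `l+2` does not see a swap at level `l+1`: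
`legChain kc (update K (l+1) M) N (l+2) q = legChain kc K N (l+2) q`. -/
theorem legChain_update_below (l q : ℕ) (M : MKer (d + 1) (Fib d)) :
    legChain kc (Function.update K (l + 1) M) N (l + 2) q = legChain kc K N (l + 2) q :=
  legChain_congr (fun j h1 _ => by rw [Function.update_of_ne (show j ≠ l + 1 by omega)]) (fun _ _ _ => rfl)

end Reroot

end Summit.QuantumFields.BalabanUV.Beta.GAN24.MixedSlotCarrier

end
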